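import Summits.BirchSwinnertonDyer.BirchSwinnertonDyer.Theorems.ResidualThetaTransportAtTwoThetaLayerLambdaCongruenceAtTwoCuspSpanPotential
import HarnessLib

/-!
# Route `ResidualThetaTransportAtTwo`, cruxes Kan⁺ (stmt-BirchSwinnertonDyer-20688) / node 27436 / 21437: the POTENTIAL of an
# additive `𝔽₂`-character of `Γ₀(pq)` exists (`p ≠ q` primes) — orbit representatives of the four cusp types at a
# squarefree two-prime level

Cell `bsd-wall`, lead prover `bsd-wall-rtt-p3` g10 (2026-08-28). THEOREMS ONLY (no `def`, no `sorry`);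
`--supports stmt-BirchSwinnertonDyer-20688`; BSD is not proved by this. Sequel to `…CuspSpanPotential` (the engine), first half
of the `B₁`-generation theorem at level `pq` (`…CuspSpanB1GenTwoPrimes`).

* §0 arithmetic at level `N = pq` and two level-free tools: `dvd_act_iff` (for a prime `ℓ ∣ N` the divisibility `ℓ ∣ y` of the
  second coordinate is `Γ₀(N)`-invariant), `isCoprime_act`, `chi_eq_add_of_act` (transport of `χ` along a base vector).
* §1 ORBITS: every primitive vector `(x, y)` is `γ e`, `γ ∈ Γ₀(N)`, for the base vector `e` of its type —
  `(0,1)` (`y` prime to `N`, any level), `(1,0)` (`N ∣ y`, any level), `(1,p)` (`p ∣ y`, `q ∤ y`; Bézout: with `m x + n y = 1`,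
  `y = p y'`, `r y + s q = 1` take `d = m + (y' − m) r y`, `b = −n + (y' − m) r x`, `a = x − b p`, `c = N (y' − m) s`), `(1,q)`;
  hence **`exists_potential_twoPrimes`**: a function `φ : ℤ → ℤ → ZMod 2` with `φ(γ v) = χ γ + φ v` for all `γ ∈ Γ₀(pq)` and
  primitive `v`, normalised by `φ(0,1) = φ(1,0) = φ(1,p) = φ(1,q) = 0`.

References: [Manin1972] §1.5 (Manin symbols are indexed by `P¹(ℤ/N)`); [Rademacher1929] §1; [Knapp1993] Prop. 11.1;
[Pollack2003] Conj. 6.3 (the node served).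
-/

set_option autoImplicit false
set_option linter.dupNamespace false

noncomputable section

open scoped MatrixGroups

open CongruenceSubgroup Literature.NumberTheory.EllipticCurves.ModularForms

namespace Summit.BirchSwinnertonDyer.BirchSwinnertonDyer.Theorems.SignedMuAtTwo

namespace Potential

variable {p q N : ℕ} {χ : Gamma0 N → ZMod 2} {φ : ℤ → ℤ → ZMod 2}

/-! ## §0. Arithmetic of the level `N = pq` -/

/-- Distinct primes are coprime in `ℤ`. [folklore] -/
theorem isCoprime_of_prime_ne (hp : p.Prime) (hq : q.Prime) (hpq : p ≠ q) : IsCoprime (p : ℤ) (q : ℤ) :=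
  Nat.isCoprime_iff_coprime.mpr ((Nat.coprime_primes hp hq).mpr hpq)

/-- `p ∣ x` and `p ∣ x + 1` is impossible for a prime `p`. [folklore] -/
theorem not_dvd_add_one_of_dvd (hp : p.Prime) {x : ℤ} (h : (p : ℤ) ∣ x) : ¬ (p : ℤ) ∣ x + 1 := by
  intro h'
  have h1 : (p : ℤ) ∣ 1 := by simpa using dvd_sub h' h
  exact (Nat.prime_iff_prime_int.mp hp).not_dvd_one h1

/-- At level `N = pq`: an integer divisible by neither `p` nor `q` is prime to `N`. [folklore] -/
theorem isCoprime_level_of_not_dvd (hp : p.Prime) (hq : q.Prime) (hN : N = p * q) {y : ℤ}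
    (hpy : ¬ (p : ℤ) ∣ y) (hqy : ¬ (q : ℤ) ∣ y) : IsCoprime y (N : ℤ) := by
  rw [hN]; push_cast
  exact (((Irreducible.coprime_iff_not_dvd (Nat.prime_iff_prime_int.mp hp).irreducible).mpr hpy).mul_left
    ((Irreducible.coprime_iff_not_dvd (Nat.prime_iff_prime_int.mp hq).irreducible).mpr hqy)).symm

/-- At level `N = pq`: an integer divisible by `p` and `q` is divisible by `N`. [folklore] -/
theorem dvd_level_of_dvd_dvd (hp : p.Prime) (hq : q.Prime) (hpq : p ≠ q) (hN : N = p * q) {y : ℤ}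
    (hpy : (p : ℤ) ∣ y) (hqy : (q : ℤ) ∣ y) : (N : ℤ) ∣ y := by
  rw [hN]; push_cast
  exact (isCoprime_of_prime_ne hp hq hpq).mul_dvd hpy hqy

/-- For a prime `ℓ ∣ N` and `γ ∈ Γ₀(N)`: `ℓ ∣ c x + d y ↔ ℓ ∣ y` (`ℓ ∣ c`, `d` a unit mod `ℓ`). [folklore] -/
theorem dvd_act_iff {ℓ : ℕ} (hℓN : ℓ ∣ N) (γ : Gamma0 N) (x y : ℤ) :
    (ℓ : ℤ) ∣ (γ : SL(2, ℤ)) 1 0 * x + (γ : SL(2, ℤ)) 1 1 * y ↔ (ℓ : ℤ) ∣ y := by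
  have hc : (ℓ : ℤ) ∣ (γ : SL(2, ℤ)) 1 0 := by
    have h := γ.2
    rw [Gamma0_mem] at h
    exact dvd_trans (Int.natCast_dvd_natCast.mpr hℓN) ((ZMod.intCast_zmod_eq_zero_iff_dvd _ N).mp h)
  have hd : IsCoprime (ℓ : ℤ) ((γ : SL(2, ℤ)) 1 1) := by
    obtain ⟨t, ht⟩ := hc
    refine ⟨-((γ : SL(2, ℤ)) 0 1 * t), (γ : SL(2, ℤ)) 0 0, ?_⟩
    linear_combination det_entries (γ : SL(2, ℤ)) + (γ : SL(2, ℤ)) 0 1 * ht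
  constructor
  · intro h
    have h' : (ℓ : ℤ) ∣ (γ : SL(2, ℤ)) 1 1 * y := by
      have := dvd_sub h (dvd_mul_of_dvd_left hc x)
      rwa [add_sub_cancel_left] at this
    exact hd.dvd_of_dvd_mul_left h'
  · intro h
    exact dvd_add (dvd_mul_of_dvd_left hc x) (dvd_mul_of_dvd_right h _)

/-- `Γ₀(N)` maps primitive vectors to primitive vectors. [folklore] -/
theorem isCoprime_act (γ : Gamma0 N) {x y : ℤ} (hxy : IsCoprime x y) :
    IsCoprime ((γ : SL(2, ℤ)) 0 0 * x + (γ : SL(2, ℤ)) 0 1 * y) ((γ : SL(2, ℤ)) 1 0 * x + (γ : SL(2, ℤ)) 1 1 * y) := by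
  obtain ⟨u, v, huv⟩ := hxy
  refine ⟨u * (γ : SL(2, ℤ)) 1 1 - v * (γ : SL(2, ℤ)) 1 0, v * (γ : SL(2, ℤ)) 0 0 - u * (γ : SL(2, ℤ)) 0 1, ?_⟩
  linear_combination (u * x + v * y) * det_entries (γ : SL(2, ℤ)) + huv

/-- **Transport of `χ` along a base vector**: if `γ₀ e = (x, y)` and `γ₁ e = γ (x, y)` for a non-zero integer vector `e`, then
`χ γ₁ = χ γ + χ γ₀` (`γ₁` and `γ γ₀` agree on `e`; `chi_eq_of_act_eq`). [folklore] -/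
theorem chi_eq_add_of_act (hadd : ∀ γ δ : Gamma0 N, χ (γ * δ) = χ γ + χ δ)
    (hsmall : ∀ γ : Gamma0 N, ((γ : SL(2, ℤ)) 0 0 + (γ : SL(2, ℤ)) 1 1).natAbs ≤ 2 → χ γ = 0)
    (γ γ₀ γ₁ : Gamma0 N) {e₀ e₁ x y : ℤ} (he : e₀ ≠ 0 ∨ e₁ ≠ 0)
    (h0 : (γ₀ : SL(2, ℤ)) 0 0 * e₀ + (γ₀ : SL(2, ℤ)) 0 1 * e₁ = x) (h1 : (γ₀ : SL(2, ℤ)) 1 0 * e₀ + (γ₀ : SL(2, ℤ)) 1 1 * e₁ = y)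
    (k0 : (γ₁ : SL(2, ℤ)) 0 0 * e₀ + (γ₁ : SL(2, ℤ)) 0 1 * e₁ = (γ : SL(2, ℤ)) 0 0 * x + (γ : SL(2, ℤ)) 0 1 * y)
    (k1 : (γ₁ : SL(2, ℤ)) 1 0 * e₀ + (γ₁ : SL(2, ℤ)) 1 1 * e₁ = (γ : SL(2, ℤ)) 1 0 * x + (γ : SL(2, ℤ)) 1 1 * y) :
    χ γ₁ = χ γ + χ γ₀ := by
  rw [← hadd]
  refine chi_eq_of_act_eq hadd hsmall he ?_ ?_
  · rw [k0, gamma0_mul_apply_zero_zero', gamma0_mul_apply_zero_one, ← h0, ← h1]; ring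
  · rw [k1, ThetaLayerLambdaCongruenceAtTwo.gamma0_mul_apply_one_zero, gamma0_mul_apply_one_one', ← h0, ← h1]; ring

/-! ## §1. Orbit representatives of the four types and the potential -/

/-- **Type `1`** (`y` prime to `N`, any level): `(x, y) = γ (0, 1)` for some `γ ∈ Γ₀(N)`. [folklore] -/
theorem exists_act_base_unit {x y : ℤ} (hxy : IsCoprime x y) (hy : IsCoprime y (N : ℤ)) :
    ∃ γ : Gamma0 N, (γ : SL(2, ℤ)) 0 0 * 0 + (γ : SL(2, ℤ)) 0 1 * 1 = x ∧
      (γ : SL(2, ℤ)) 1 0 * 0 + (γ : SL(2, ℤ)) 1 1 * 1 = y := by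
  obtain ⟨a, k, hak⟩ := (hy.mul_right hxy.symm : IsCoprime y (N * x))
  obtain ⟨γ, -, h01, -, h11⟩ := ThetaLayerLambdaCongruenceAtTwo.exists_gamma0_entries (N := N)
    a x (-(N * k)) y (by linear_combination hak) ⟨-k, by ring⟩
  exact ⟨γ, by rw [h01]; ring, by rw [h11]; ring⟩

/-- **Type `N`** (`N ∣ y`, any level): `(x, y) = γ (1, 0)` for some `γ ∈ Γ₀(N)`. [folklore] -/
theorem exists_act_base_top {x y : ℤ} (hxy : IsCoprime x y) (hy : (N : ℤ) ∣ y) :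
    ∃ γ : Gamma0 N, (γ : SL(2, ℤ)) 0 0 * 1 + (γ : SL(2, ℤ)) 0 1 * 0 = x ∧
      (γ : SL(2, ℤ)) 1 0 * 1 + (γ : SL(2, ℤ)) 1 1 * 0 = y := by
  obtain ⟨m, n, hmn⟩ := hxy
  obtain ⟨γ, h00, -, h10, -⟩ := ThetaLayerLambdaCongruenceAtTwo.exists_gamma0_entries (N := N)
    x (-n) y m (by linear_combination hmn) hy
  exact ⟨γ, by rw [h00]; ring, by rw [h10]; ring⟩

/-- **Type `p`** at level `N = pq` (`p ∣ y`, `q ∤ y`): `(x, y) = γ (1, p)` for some `γ ∈ Γ₀(N)` — with `m x + n y = 1`,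
`y = p y'` and `r y + s q = 1`, take `d = m + (y' − m) r y`, `b = −n + (y' − m) r x`, `a = x − b p`, `c = N (y' − m) s`.
[folklore] -/
theorem exists_act_base_left (hq : q.Prime) (hN : N = p * q) {x y : ℤ} (hxy : IsCoprime x y)
    (hpy : (p : ℤ) ∣ y) (hqy : ¬ (q : ℤ) ∣ y) :
    ∃ γ : Gamma0 N, (γ : SL(2, ℤ)) 0 0 * 1 + (γ : SL(2, ℤ)) 0 1 * p = x ∧
      (γ : SL(2, ℤ)) 1 0 * 1 + (γ : SL(2, ℤ)) 1 1 * p = y := by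
  obtain ⟨m, n, hmn⟩ := hxy
  obtain ⟨y', hy'⟩ := hpy
  obtain ⟨r, s, hrs⟩ := ((Irreducible.coprime_iff_not_dvd (Nat.prime_iff_prime_int.mp hq).irreducible).mpr hqy).symm
  have hNz : (N : ℤ) = p * q := by rw [hN]; push_cast; ring
  obtain ⟨γ, h00, h01, h10, h11⟩ := ThetaLayerLambdaCongruenceAtTwo.exists_gamma0_entries (N := N)
    (x - (-n + (y' - m) * r * x) * p) (-n + (y' - m) * r * x) ((N : ℤ) * ((y' - m) * s)) (m + (y' - m) * r * y)
    (by
      rw [hNz]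
      linear_combination hmn + (-n + (y' - m) * r * x) * hy' - (-n + (y' - m) * r * x) * p * (y' - m) * hrs)
    (dvd_mul_right _ _)
  refine ⟨γ, by rw [h00, h01]; ring, ?_⟩
  rw [h10, h11, hNz]
  linear_combination (p : ℤ) * (y' - m) * hrs - hy'

/-- **The potential at level `pq`.** For an additive `χ : Γ₀(pq) → 𝔽₂` killing the trace-`±2` elements there is
`φ : ℤ → ℤ → 𝔽₂` with `φ(γ(x,y)) = χ γ + φ(x,y)` for all `γ ∈ Γ₀(pq)` and primitive `(x,y)`, normalised by
`φ(0,1) = φ(1,0) = φ(1,p) = φ(1,q) = 0` (`φ(v) := χ γ_v` for a chosen `γ_v` carrying the base vector of the type of `v` to `v`;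
well defined and additive by `chi_eq_of_act_eq`, the type `(p ∣ y, q ∣ y)` being `Γ₀(N)`-invariant). [folklore] -/
theorem exists_potential_twoPrimes (hp : p.Prime) (hq : q.Prime) (hpq : p ≠ q) (hN : N = p * q)
    (hadd : ∀ γ δ : Gamma0 N, χ (γ * δ) = χ γ + χ δ)
    (hsmall : ∀ γ : Gamma0 N, ((γ : SL(2, ℤ)) 0 0 + (γ : SL(2, ℤ)) 1 1).natAbs ≤ 2 → χ γ = 0) :
    ∃ φ : ℤ → ℤ → ZMod 2,
      (∀ (γ : Gamma0 N) (x y : ℤ), IsCoprime x y →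
        φ ((γ : SL(2, ℤ)) 0 0 * x + (γ : SL(2, ℤ)) 0 1 * y) ((γ : SL(2, ℤ)) 1 0 * x + (γ : SL(2, ℤ)) 1 1 * y) = χ γ + φ x y) ∧
      φ 0 1 = 0 ∧ φ 1 0 = 0 ∧ φ 1 p = 0 ∧ φ 1 q = 0 := by
  classical
  have hpN : p ∣ N := hN ▸ dvd_mul_right p q
  have hqN : q ∣ N := hN ▸ dvd_mul_left q p
  have hN' : N = q * p := by rw [hN, mul_comm]
  choose! Gu hGu using fun (x y : ℤ) (h : IsCoprime x y) (h' : IsCoprime y (N : ℤ)) ↦ exists_act_base_unit (N := N) h h'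
  choose! Gt hGt using fun (x y : ℤ) (h : IsCoprime x y) (h' : (N : ℤ) ∣ y) ↦ exists_act_base_top (N := N) h h'
  choose! Gl hGl using fun (x y : ℤ) (h : IsCoprime x y) (h' : (p : ℤ) ∣ y) (h'' : ¬ (q : ℤ) ∣ y) ↦
    exists_act_base_left (p := p) hq hN h h' h''
  choose! Gr hGr using fun (x y : ℤ) (h : IsCoprime x y) (h' : (q : ℤ) ∣ y) (h'' : ¬ (p : ℤ) ∣ y) ↦
    exists_act_base_left (p := q) hp hN' h h' h''
  refine ⟨fun x y ↦ if (p : ℤ) ∣ y then (if (q : ℤ) ∣ y then χ (Gt x y) else χ (Gl x y))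
    else (if (q : ℤ) ∣ y then χ (Gr x y) else χ (Gu x y)), ?_, ?_, ?_, ?_, ?_⟩
  · intro γ x y hxy
    have hxy' := isCoprime_act γ hxy
    have ep := dvd_act_iff hpN γ x y
    have eq_ := dvd_act_iff hqN γ x y
    set x' := (γ : SL(2, ℤ)) 0 0 * x + (γ : SL(2, ℤ)) 0 1 * y with hx'
    set y' := (γ : SL(2, ℤ)) 1 0 * x + (γ : SL(2, ℤ)) 1 1 * y with hy'
    by_cases hpy : (p : ℤ) ∣ y
    · by_cases hqy : (q : ℤ) ∣ y
      · have hpy' : (p : ℤ) ∣ y' := ep.mpr hpy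
        have hqy' : (q : ℤ) ∣ y' := eq_.mpr hqy
        simp only [hpy, hqy, hpy', hqy', if_true]
        obtain ⟨a0, a1⟩ := hGt x y hxy (dvd_level_of_dvd_dvd hp hq hpq hN hpy hqy)
        obtain ⟨b0, b1⟩ := hGt x' y' hxy' (dvd_level_of_dvd_dvd hp hq hpq hN hpy' hqy')
        exact chi_eq_add_of_act hadd hsmall γ (Gt x y) (Gt x' y') (Or.inl one_ne_zero) a0 a1 b0 b1
      · have hpy' : (p : ℤ) ∣ y' := ep.mpr hpy
        have hqy' : ¬ (q : ℤ) ∣ y' := fun h ↦ hqy (eq_.mp h)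
        simp only [hpy, hqy, hpy', hqy', if_true, if_false]
        obtain ⟨a0, a1⟩ := hGl x y hxy hpy hqy
        obtain ⟨b0, b1⟩ := hGl x' y' hxy' hpy' hqy'
        exact chi_eq_add_of_act hadd hsmall γ (Gl x y) (Gl x' y') (Or.inl one_ne_zero) a0 a1 b0 b1
    · by_cases hqy : (q : ℤ) ∣ y
      · have hpy' : ¬ (p : ℤ) ∣ y' := fun h ↦ hpy (ep.mp h)
        have hqy' : (q : ℤ) ∣ y' := eq_.mpr hqy
        simp only [hpy, hqy, hpy', hqy', if_true, if_false]
        obtain ⟨a0, a1⟩ := hGr x y hxy hqy hpy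
        obtain ⟨b0, b1⟩ := hGr x' y' hxy' hqy' hpy'
        exact chi_eq_add_of_act hadd hsmall γ (Gr x y) (Gr x' y') (Or.inl one_ne_zero) a0 a1 b0 b1
      · have hpy' : ¬ (p : ℤ) ∣ y' := fun h ↦ hpy (ep.mp h)
        have hqy' : ¬ (q : ℤ) ∣ y' := fun h ↦ hqy (eq_.mp h)
        simp only [hpy, hqy, hpy', hqy', if_false]
        obtain ⟨a0, a1⟩ := hGu x y hxy (isCoprime_level_of_not_dvd hp hq hN hpy hqy)
        obtain ⟨b0, b1⟩ := hGu x' y' hxy' (isCoprime_level_of_not_dvd hp hq hN hpy' hqy')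
        exact chi_eq_add_of_act hadd hsmall γ (Gu x y) (Gu x' y') (Or.inr one_ne_zero) a0 a1 b0 b1
  · -- `φ(0,1)`: `Gu 0 1` fixes `(0,1)`
    have hp1 : ¬ (p : ℤ) ∣ 1 := (Nat.prime_iff_prime_int.mp hp).not_dvd_one
    have hq1 : ¬ (q : ℤ) ∣ 1 := (Nat.prime_iff_prime_int.mp hq).not_dvd_one
    simp only [hp1, hq1, if_false]
    obtain ⟨a0, a1⟩ := hGu 0 1 isCoprime_one_right (isCoprime_level_of_not_dvd hp hq hN hp1 hq1)
    exact chi_eq_zero_of_fix hsmall (Gu 0 1) (Or.inr one_ne_zero) (Or.inl rfl) (by rw [a0]; ring) (by rw [a1]; ring)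
  · -- `φ(1,0)`: `Gt 1 0` fixes `(1,0)`
    simp only [dvd_zero, if_true]
    obtain ⟨a0, a1⟩ := hGt 1 0 isCoprime_one_left (dvd_zero _)
    exact chi_eq_zero_of_fix hsmall (Gt 1 0) (Or.inl one_ne_zero) (Or.inl rfl) (by rw [a0]; ring) (by rw [a1]; ring)
  · -- `φ(1,p)`: `Gl 1 p` fixes `(1,p)`
    have hqp : ¬ (q : ℤ) ∣ (p : ℤ) := fun h ↦ hpq
      (((Nat.prime_dvd_prime_iff_eq hq hp).mp (Int.natCast_dvd_natCast.mp h)).symm)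
    simp only [dvd_refl, hqp, if_true, if_false]
    obtain ⟨a0, a1⟩ := hGl 1 p isCoprime_one_left (dvd_refl _) hqp
    exact chi_eq_zero_of_fix hsmall (Gl 1 p) (Or.inl one_ne_zero) (Or.inl rfl) (by rw [a0]; ring) (by rw [a1]; ring)
  · -- `φ(1,q)`: `Gr 1 q` fixes `(1,q)`
    have hpq' : ¬ (p : ℤ) ∣ (q : ℤ) := fun h ↦ hpq
      ((Nat.prime_dvd_prime_iff_eq hp hq).mp (Int.natCast_dvd_natCast.mp h))
    simp only [dvd_refl, hpq', if_true, if_false]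
    obtain ⟨a0, a1⟩ := hGr 1 q isCoprime_one_left (dvd_refl _) hpq'
    exact chi_eq_zero_of_fix hsmall (Gr 1 q) (Or.inl one_ne_zero) (Or.inl rfl) (by rw [a0]; ring) (by rw [a1]; ring)

end Potential

end Summit.BirchSwinnertonDyer.BirchSwinnertonDyer.Theorems.SignedMuAtTwo

end
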